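import Summits.QuantumFields.BalabanUV.Beta.SecondOrderStepLaw
import Summits.QuantumFields.BalabanUV.Beta.SpineRecursiveParity

/-!
# `BalabanUV.Beta.SecondOrderStepRemainder` — binder row D1, the W-side (L4) of the reflection binder hR, leaf (W-REM-PAR):
# THE DISPLAYED REMAINDER OF THE LEVEL STEP `SecondOrderStepLaw.quarticStep_bref_of_laws` IS ROW-PARITY-ODD AND A LOCAL BI-STENCIL FAMILY,
# hence tadpole-null against every step propagator — the hereditary remainder class of the (hT2-rem) induction
# (β sub-cell, D1 formalisation swarm seat `b2b-balaban-beta-d1-formalise-leaf-05`, gen 5; owner an2-g18's leaf (iv), journal l.11369)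

HONEST FRAMING (cell contract, verbatim): «discharging `BetaPertH` makes Bałaban's UV stability UNCONDITIONAL — a real
constructive-QFT result; it is NOT the continuum limit and NOT the Clay problem.»  HONEST DEPENDENCY (verbatim): «continuum YM on T⁴ ⇐
BetaPertH ∧ nine spine estimates (0/9 proved); BetaPertH ⇐ (D1) ∧ (D4) ∧ CAP+tail; G-an2-4 gates asym, D1 and NE2/3/4.»  This module is
[folklore] bookkeeping over tree objects BY NAME; it types no statement of Bałaban's papers, carries no `[cite:]` tag, declares no `def` and no
`Prop` fact, instantiates NO binder of the β-function wall, and is NOT D1, NOT `BetaPertH`, NOT continuum, NOT Clay.  ABSOLUTE RULE (cell,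
verbatim): «No internally-minted statement may enter as a cited fact. Every hypothesis is either kernel-proved in this package or a verbatim
quotation of a PUBLISHED theorem with page reference. The manuscript(s) under audit are NOT citable for their own disputed steps — they are the
thing under adjudication; programme-internal (2001/route/tribunal) claims are never citable.»  Nothing is cited here.

## The object

`SecondOrderStepLaw.quarticStep_bref_of_laws` (an2-g18, p215324) assembles the reflection law of a next-level second-order table and DISPLAYS
its remainder `R κ u κ′ u′ := −(a • mmRead N (R₀ κ u κ′ u′)) + RB κ u κ′ u′ + conjV (mmRead N G) (diagK fun p c => a·ĥ κuκ′u′ p c − w·hB κuκ′u′ p c)`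
— the transported remainder, the border letter's remainder, and ONE COMMUTATOR of the (parity-even) field block with a diagonal kernel.
This file proves what the END's remainder slot needs of `R`, from hypotheses on the letters `G`, `R₀`, `RB`, `ĥ`, `hB` only:

* §1 parity algebra: **`parityOdd_conjV_diagK_of_even`** — for a sgn-SYMMETRIC `𝕄` (`trK 𝕄 = sgnK 𝕄`) and ANY diagonal symbol `g`,
  `conjV 𝕄 (diagK g) = 𝕄∘diagK g − diagK g∘𝕄` is parity-ODD (the commutator lemma of the owner's memo v2 ∕ journal l.10986; twin of an1's
  `KernelWardResidual.parityEven_conjV_diagK`); `parityEven_mmRead` (the `mm`-read of a sgn-symmetric kernel is sgn-symmetric);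
  `parityOdd_mmRead_sandwich` (`mmRead N (G∘V∘G)` is parity-odd for parity-odd localised `V` — this lineage's `parityOdd_sandwich` + `parityOdd_mmRead`).
* §2 **`parityOdd_stepRemainder`**: `trK (R κ u κ′ u′) = −sgnK (R κ u κ′ u′)` ⟸ `trK G = sgnK G`, rows of `R₀` parity-odd, rows of `RB` parity-odd —
  NO hypothesis on the two second symbols (the commutator absorbs their mismatch whatever they are).
* §3 **`locStencil₂_stepRemainder`**: `LocStencil₂ R (…) (m/2)` ⟸ `LocStencil₂ (κuκ′u′ ↦ mmRead N (R₀ κuκ′u′)) C₀ m` (or, `locStencil₂_mmRead`, from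
  `R₀` bi-localised at the dilated bond with a separation-decaying constant), `LocStencil₂ RB CB m`, `Decays G CG m` (`1 ≤ N`), and the decay classes
  `LocStencil₂ (κuκ′u′ ↦ diagK (ĥ κuκ′u′)) Ch m`, `LocStencil₂ (κuκ′u′ ↦ diagK (hB κuκ′u′)) CB′ m` of the two second symbols
  (`locStencil₂_conjV_diagK`: Literature `biLoc_comp_decays` ∕ `biLoc_comp_right`).
* §4 zero tadpole of every member of `R` against any spread sgn-symmetric `G′` (an1's `tadpole_eq_zero_of_parity`): `tadpole_stepRemainder_eq_zero`;
  the WALL INSTANCE (`G := G_j`, `N := Lc`, tadpole against `G_i`, transported remainder as the sandwiched residual `G_j ∘ V ∘ G_j`) is the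
  sequel `SecondOrderStepRemainderWall`.
NOT HERE: the letters (`R₀`'s law is the previous level's (hT2-rem), `RB` is an1's border letter), the induction, the END `…_JsRecWAtOf_rem` (owner).
Provenance: b2b-balaban β sub-cell, D1 formalisation swarm leaf-05 gen 5, 2026-08-20 (v1); no existing file touched.
-/

noncomputable section

open Finset
open scoped BigOperators
open Literature.MathematicalPhysics.QuantumFieldTheory
open Literature.MathematicalPhysics.QuantumFieldTheory.Balaban1983to89
open Literature.MathematicalPhysics.QuantumFieldTheory.Balaban1983to89.Beta
open B12Sec2to5 (l1 l1_nonneg)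
open ExpKernelCalculus (MKer Decays BiLoc comp tadpole Zl Zl_nonneg biLoc_comp_decays)
open KernelWard (biLoc_add)
open AffineAveraging (box toSite)
open OneStepResolventKernel (Fib decays_mono)
open OneStepKernelFamily (KInvStep)
open BalabanStepJetsSucc (mmRead mmRead_inl_inl decays_mmRead biLoc_mmRead biLoc_comp_right l1_sub_le_l1_smul_sub)
open BalabanCompositeJets (LocStencil₂)
open BalabanStepW2 (biLoc_le_mono)
open SecondOrderResponse (biLoc_neg biLoc_smul)
open Summit.QuantumFields.BalabanUV.Beta.TameKernelCalculus
open Summit.QuantumFields.BalabanUV.Beta.BorderedHessian (sgnF sgnF_inl sgnF_inr sgnK sgnK_apply diagK conjV_diagK_apply)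
open Summit.QuantumFields.BalabanUV.Beta.BubbleParity (spr_of_decays trK_coDressKBmAt_KInvStep)
open Summit.QuantumFields.BalabanUV.Beta.ChartConjugation (conjV)
open Summit.QuantumFields.BalabanUV.Beta.AxialDressingRooted (coDressKBmAt decays_coDressKBmAt_KInvStep)
open Summit.QuantumFields.BalabanUV.Beta.KernelWardRelativeEnd (tadpole_eq_zero_of_parity)
open Summit.QuantumFields.BalabanUV.Beta.KernelWardRemainderParity (parityOdd_add)
open Summit.QuantumFields.BalabanUV.Beta.SpineRecursiveParity (parityOdd_smul parityOdd_neg parityOdd_sandwich parityOdd_mmRead)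

namespace Summit.QuantumFields.BalabanUV.Beta.SecondOrderStepRemainder

variable {d : ℕ}

/-! ## §1 Parity algebra: the commutator lemma, the `mm`-read of a sgn-symmetric kernel, the transported sandwich -/

section ParityAlgebra

/-- [folklore] **THE COMMUTATOR LEMMA**: for a sgn-SYMMETRIC kernel `𝕄` (`trK 𝕄 = sgnK 𝕄`) and ANY diagonal symbol `g`, the first-order
contact `conjV 𝕄 (diagK g) = 𝕄∘diagK g − diagK g∘𝕄` is row-parity-ODD: `trK (conjV 𝕄 (diagK g)) = −sgnK (conjV 𝕄 (diagK g))`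
(entrywise: `conjV 𝕄 (diagK g) x z a b = 𝕄 x z a b·(g z b − g x a)`, antisymmetric in the symbol factor). -/
theorem parityOdd_conjV_diagK_of_even (g : (Fin (d + 1) → ℤ) → Fib d → ℝ) {𝕄 : MKer (d + 1) (Fib d)} (h : trK 𝕄 = sgnK 𝕄) :
    trK (conjV 𝕄 (diagK g)) = -sgnK (conjV 𝕄 (diagK g)) := by
  funext x z a b
  have e := congrArg (fun K => K x z a b) h
  simp only [trK_apply, sgnK_apply] at e
  simp only [trK_apply, Pi.neg_apply, sgnK_apply]
  rw [conjV_diagK_apply, conjV_diagK_apply, e]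
  ring

/-- [folklore] **THE `mm`-READ OF A sgn-SYMMETRIC KERNEL IS sgn-SYMMETRIC** (its only non-zero block is the symmetric mm-block of `F` at
dilated points, placed on the field legs). -/
theorem parityEven_mmRead (M : ℕ) {F : MKer (d + 1) (Fib d)} (h : trK F = sgnK F) : trK (mmRead M F) = sgnK (mmRead M F) := by
  funext x z a b
  rcases a with α | μ <;> rcases b with β | ν
  · have hF := congrFun (congrFun (congrFun (congrFun h ((M : ℤ) • x)) ((M : ℤ) • z)) (Sum.inr α)) (Sum.inr β)
    simp only [trK_apply, sgnK_apply, sgnF_inr] at hF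
    simp only [trK_apply, sgnK_apply, mmRead_inl_inl, sgnF_inl, one_mul]
    rw [hF]
    ring
  · simp [trK_apply, sgnK_apply]
  · simp [trK_apply, sgnK_apply]
  · simp [trK_apply, sgnK_apply]

/-- [folklore] Hence the commutator of the `mm`-read field block with a diagonal kernel is parity-odd. -/
theorem parityOdd_conjV_mmRead_diagK (M : ℕ) (g : (Fin (d + 1) → ℤ) → Fib d → ℝ) {G : MKer (d + 1) (Fib d)} (hG : trK G = sgnK G) :
    trK (conjV (mmRead M G) (diagK g)) = -sgnK (conjV (mmRead M G) (diagK g)) :=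
  parityOdd_conjV_diagK_of_even g (parityEven_mmRead M hG)

/-- [folklore] **THE TRANSPORTED SANDWICH IS PARITY-ODD**: for a spread sgn-symmetric `G` and a localised parity-odd `V`,
`mmRead M (G ∘ V ∘ G)` is parity-odd (this lineage's `parityOdd_sandwich` + `parityOdd_mmRead`) — the shape of `R₀`. -/
theorem parityOdd_mmRead_sandwich (M : ℕ) {G V : MKer (d + 1) (Fib d)} (hGs : Spr G) (hGt : trK G = sgnK G) (hV : Loc V)
    (hVt : trK V = -sgnK V) : trK (mmRead M (comp (comp G V) G)) = -sgnK (mmRead M (comp (comp G V) G)) :=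
  parityOdd_mmRead M (parityOdd_sandwich hGs hV hGt hVt)

end ParityAlgebra

/-! ## §2 The displayed remainder is row-parity-odd -/

section Parity

variable {N : ℕ} {G : MKer (d + 1) (Fib d)} {R₀ RB : Fin (d + 1) → (Fin (d + 1) → ℤ) → Fin (d + 1) → (Fin (d + 1) → ℤ) → MKer (d + 1) (Fib d)}

/-- [folklore] **THE DISPLAYED REMAINDER OF `quarticStep_bref_of_laws` IS ROW-PARITY-ODD, FOR ANY SECOND SYMBOLS**: with `G` sgn-symmetric,
the rows of `R₀` and of `RB` parity-odd, and ANY symbol family `f`,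
`trK (−(a • mmRead N (R₀ κuκ′u′)) + RB κuκ′u′ + conjV (mmRead N G) (diagK (f κuκ′u′))) = −sgnK (…)`. -/
theorem parityOdd_stepRemainder_symbol (hG : trK G = sgnK G) (h₀ : ∀ κ u κ' u', trK (R₀ κ u κ' u') = -sgnK (R₀ κ u κ' u'))
    (hB : ∀ κ u κ' u', trK (RB κ u κ' u') = -sgnK (RB κ u κ' u')) (a : ℝ)
    (f : Fin (d + 1) → (Fin (d + 1) → ℤ) → Fin (d + 1) → (Fin (d + 1) → ℤ) → (Fin (d + 1) → ℤ) → Fib d → ℝ)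
    (κ : Fin (d + 1)) (u : Fin (d + 1) → ℤ) (κ' : Fin (d + 1)) (u' : Fin (d + 1) → ℤ) :
    trK (-(a • mmRead N (R₀ κ u κ' u')) + RB κ u κ' u' + conjV (mmRead N G) (diagK (f κ u κ' u'))) =
      -sgnK (-(a • mmRead N (R₀ κ u κ' u')) + RB κ u κ' u' + conjV (mmRead N G) (diagK (f κ u κ' u'))) :=
  parityOdd_add (parityOdd_add (parityOdd_neg (parityOdd_smul a (parityOdd_mmRead N (h₀ κ u κ' u')))) (hB κ u κ' u'))
    (parityOdd_conjV_mmRead_diagK N _ hG)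

/-- [folklore] **THE SAME IN THE LITERAL DISPLAY** of `SecondOrderStepLaw.quarticStep_bref_of_laws`: symbol `p c ↦ a·ĥ κuκ′u′ p c − w·hB κuκ′u′ p c`. -/
theorem parityOdd_stepRemainder (hG : trK G = sgnK G) (h₀ : ∀ κ u κ' u', trK (R₀ κ u κ' u') = -sgnK (R₀ κ u κ' u'))
    (hB : ∀ κ u κ' u', trK (RB κ u κ' u') = -sgnK (RB κ u κ' u')) (a w : ℝ)
    (hh hB' : Fin (d + 1) → (Fin (d + 1) → ℤ) → Fin (d + 1) → (Fin (d + 1) → ℤ) → (Fin (d + 1) → ℤ) → Fib d → ℝ)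
    (κ : Fin (d + 1)) (u : Fin (d + 1) → ℤ) (κ' : Fin (d + 1)) (u' : Fin (d + 1) → ℤ) :
    trK (-(a • mmRead N (R₀ κ u κ' u')) + RB κ u κ' u' +
        conjV (mmRead N G) (diagK fun p c => a * hh κ u κ' u' p c - w * hB' κ u κ' u' p c)) =
      -sgnK (-(a • mmRead N (R₀ κ u κ' u')) + RB κ u κ' u' +
        conjV (mmRead N G) (diagK fun p c => a * hh κ u κ' u' p c - w * hB' κ u κ' u' p c)) :=
  parityOdd_stepRemainder_symbol hG h₀ hB a (fun κ u κ' u' p c => a * hh κ u κ' u' p c - w * hB' κ u κ' u' p c) κ u κ' u'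

end Parity

/-! ## §3 The displayed remainder is a local bi-stencil family -/

section Localisation

variable {N : ℕ}

/-- [folklore] A member of a local bi-stencil family is a localised kernel. -/
theorem loc_of_locStencil₂ {S₂ : Fin (d + 1) → (Fin (d + 1) → ℤ) → Fin (d + 1) → (Fin (d + 1) → ℤ) → MKer (d + 1) (Fib d)} {C δ : ℝ}
    (h : LocStencil₂ S₂ C δ) (hδ : 0 < δ) (κ : Fin (d + 1)) (u : Fin (d + 1) → ℤ) (κ' : Fin (d + 1)) (u' : Fin (d + 1) → ℤ) :
    Loc (S₂ κ u κ' u') :=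
  ⟨u, u, _, δ, hδ, h κ u κ' u'⟩

/-- [folklore] **THE `mm`-READ OF A FAMILY BI-LOCALISED AT THE DILATED BOND** with a separation-decaying constant is a `LocStencil₂` family
(Literature `biLoc_mmRead`; the dilation only helps, `1 ≤ N`) — the transported-remainder socket from the previous level's currency. -/
theorem locStencil₂_mmRead (hN : 1 ≤ N)
    {R₀ : Fin (d + 1) → (Fin (d + 1) → ℤ) → Fin (d + 1) → (Fin (d + 1) → ℤ) → MKer (d + 1) (Fib d)} {C m : ℝ} (hm : 0 ≤ m)
    (h : ∀ κ u κ' u', BiLoc (R₀ κ u κ' u') ((N : ℤ) • u) ((N : ℤ) • u) (C * Real.exp (-m * l1 (u' - u))) m) :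
    LocStencil₂ (fun κ u κ' u' => mmRead N (R₀ κ u κ' u')) C m :=
  fun κ u κ' u' => biLoc_mmRead hN (h κ u κ' u') hm

/-- [folklore] **THE TRANSPORTED SANDWICH IS A `LocStencil₂` FAMILY**: for `G` decaying at rate `m` and a residual family `V κ u κ′ u′`
bi-localised at the DILATED bond `(N•u, N•u)` with a separation-decaying constant `Cv·e^{−m|u′−u|}` (the shape the level-`j` residual has on the
fine lattice), `κuκ′u′ ↦ mmRead N (G ∘ V κuκ′u′ ∘ G)` is a `LocStencil₂` family at rate `m/4` (`biLoc_comp_decays`, `biLoc_comp_right`, `biLoc_mmRead`). -/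
theorem locStencil₂_mmRead_sandwich (hN : 1 ≤ N) {G : MKer (d + 1) (Fib d)} {CG m : ℝ} (hGd : Decays G CG m) (hm : 0 < m)
    {V : Fin (d + 1) → (Fin (d + 1) → ℤ) → Fin (d + 1) → (Fin (d + 1) → ℤ) → MKer (d + 1) (Fib d)} {Cv : ℝ}
    (hV : ∀ κ u κ' u', BiLoc (V κ u κ' u') ((N : ℤ) • u) ((N : ℤ) • u) (Cv * Real.exp (-m * l1 (u' - u))) m) :
    LocStencil₂ (fun κ u κ' u' => mmRead N (comp (comp G (V κ u κ' u')) G))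
      ((Fintype.card (Fib d) : ℝ) * ((Fintype.card (Fib d) : ℝ) * (CG * Cv) * Zl (d + 1) (m / 2) * CG) * Zl (d + 1) (m / 4)) (m / 4) := by
  have hCG : 0 ≤ CG := hGd.nonneg (Sum.inl 0)
  have hZ2 : 0 ≤ Zl (d + 1) (m / 2) := Zl_nonneg (half_pos hm)
  have hZ4 : 0 ≤ Zl (d + 1) (m / 4) := Zl_nonneg (by positivity)
  have hG2 : Decays G CG (m / 2) := decays_mono hGd hCG le_rfl (half_le_self hm.le)
  intro κ u κ' u'
  have hVk := hV κ u κ' u'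
  have hCvu : 0 ≤ Cv * Real.exp (-m * l1 (u' - u)) := hVk.nonneg (Sum.inl 0)
  have hCv : 0 ≤ Cv := (mul_nonneg_iff_of_pos_right (Real.exp_pos _)).mp hCvu
  have h1 := biLoc_comp_decays hGd hVk (show (0 : ℝ) ≤ m / 2 by positivity) (half_lt_self hm)
  rw [show m - m / 2 = m / 2 by ring] at h1
  have h2 := biLoc_comp_right h1 hG2 (show (0 : ℝ) ≤ m / 4 by positivity) (by linarith)
  rw [show m / 2 - m / 4 = m / 4 by ring] at h2
  have hexp : Real.exp (-m * l1 (u' - u)) ≤ Real.exp (-(m / 4) * l1 (u' - u)) :=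
    Real.exp_le_exp.2 (by nlinarith [l1_nonneg (u' - u)])
  have h3 : BiLoc (comp (comp G (V κ u κ' u')) G) ((N : ℤ) • u) ((N : ℤ) • u)
      ((Fintype.card (Fib d) : ℝ) * ((Fintype.card (Fib d) : ℝ) * (CG * Cv) * Zl (d + 1) (m / 2) * CG) * Zl (d + 1) (m / 4) *
        Real.exp (-(m / 4) * l1 (u' - u))) (m / 4) := by
    refine biLoc_le_mono h2 (by positivity) ?_ le_rfl
    calc (Fintype.card (Fib d) : ℝ) * ((Fintype.card (Fib d) : ℝ) * (CG * (Cv * Real.exp (-m * l1 (u' - u)))) * Zl (d + 1) (m / 2) * CG) *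
          Zl (d + 1) (m / 4)
        = (Fintype.card (Fib d) : ℝ) * ((Fintype.card (Fib d) : ℝ) * (CG * Cv) * Zl (d + 1) (m / 2) * CG) * Zl (d + 1) (m / 4) *
            Real.exp (-m * l1 (u' - u)) := by ring
      _ ≤ _ := mul_le_mul_of_nonneg_left hexp (by positivity)
  exact biLoc_mmRead hN h3 (by positivity)

/-- [folklore] **THE COMMUTATOR OF A DECAYING KERNEL WITH A LOCAL DIAGONAL BI-FAMILY IS A `LocStencil₂` FAMILY** (rate `m/2`):
`Decays 𝕄 C m`, `LocStencil₂ (κuκ′u′ ↦ diagK (f κuκ′u′)) Cf m` ⇒ `LocStencil₂ (κuκ′u′ ↦ conjV 𝕄 (diagK (f κuκ′u′))) (2·#F·C·Cf·Zl(m/2)) (m/2)`. -/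
theorem locStencil₂_conjV_diagK {𝕄 : MKer (d + 1) (Fib d)} {C m : ℝ} (h𝕄 : Decays 𝕄 C m) (hm : 0 < m)
    {f : Fin (d + 1) → (Fin (d + 1) → ℤ) → Fin (d + 1) → (Fin (d + 1) → ℤ) → (Fin (d + 1) → ℤ) → Fib d → ℝ} {Cf : ℝ}
    (hf : LocStencil₂ (fun κ u κ' u' => diagK (f κ u κ' u')) Cf m) :
    LocStencil₂ (fun κ u κ' u' => conjV 𝕄 (diagK (f κ u κ' u')))
      (2 * (Fintype.card (Fib d) : ℝ) * C * Cf * Zl (d + 1) (m / 2)) (m / 2) := by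
  have hC : 0 ≤ C := h𝕄.nonneg (Sum.inl 0)
  have hCf : 0 ≤ Cf := hf.nonneg
  have hZ : 0 ≤ Zl (d + 1) (m / 2) := Zl_nonneg (half_pos hm)
  intro κ u κ' u'
  have h0 : (0 : ℝ) ≤ m / 2 := by positivity
  have h1 : m / 2 < m := half_lt_self hm
  have hmm : m - m / 2 = m / 2 := by ring
  have hfk := hf κ u κ' u'
  have e1 := biLoc_comp_decays h𝕄 hfk h0 h1
  have e2 := biLoc_comp_right hfk h𝕄 h0 h1
  rw [hmm] at e1 e2
  have hexp : Real.exp (-m * l1 (u' - u)) ≤ Real.exp (-(m / 2) * l1 (u' - u)) :=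
    Real.exp_le_exp.2 (by nlinarith [l1_nonneg (u' - u)])
  have hsub := KernelWard.biLoc_sub e1 e2
  refine biLoc_le_mono hsub (by positivity) ?_ le_rfl
  have key : (Fintype.card (Fib d) : ℝ) * (C * (Cf * Real.exp (-m * l1 (u' - u)))) * Zl (d + 1) (m / 2) +
      (Fintype.card (Fib d) : ℝ) * (Cf * Real.exp (-m * l1 (u' - u)) * C) * Zl (d + 1) (m / 2) =
      (2 * (Fintype.card (Fib d) : ℝ) * C * Cf * Zl (d + 1) (m / 2)) * Real.exp (-m * l1 (u' - u)) := by ring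
  rw [key]
  exact mul_le_mul_of_nonneg_left hexp (by positivity)

variable {G : MKer (d + 1) (Fib d)} {R₀ RB : Fin (d + 1) → (Fin (d + 1) → ℤ) → Fin (d + 1) → (Fin (d + 1) → ℤ) → MKer (d + 1) (Fib d)}

/-- [folklore] **THE DISPLAYED REMAINDER IS A `LocStencil₂` FAMILY, FOR ANY LOCAL SECOND SYMBOL** `f` (rate `m/2`; all inputs at a common rate `m`):
the transported remainder's class `LocStencil₂ (κuκ′u′ ↦ mmRead N (R₀ κuκ′u′)) C₀ m`, the border remainder's `LocStencil₂ RB CB m`, the decay of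
`G` (`1 ≤ N`), and the decay class of the symbol `LocStencil₂ (κuκ′u′ ↦ diagK (f κuκ′u′)) Cf m`. -/
theorem locStencil₂_stepRemainder_symbol (hN : 1 ≤ N) {CG C₀ CB Cf m : ℝ} (hm : 0 < m) (hGd : Decays G CG m)
    (h₀ : LocStencil₂ (fun κ u κ' u' => mmRead N (R₀ κ u κ' u')) C₀ m) (hB : LocStencil₂ RB CB m) (a : ℝ)
    {f : Fin (d + 1) → (Fin (d + 1) → ℤ) → Fin (d + 1) → (Fin (d + 1) → ℤ) → (Fin (d + 1) → ℤ) → Fib d → ℝ}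
    (hf : LocStencil₂ (fun κ u κ' u' => diagK (f κ u κ' u')) Cf m) :
    LocStencil₂ (fun κ u κ' u' => -(a • mmRead N (R₀ κ u κ' u')) + RB κ u κ' u' + conjV (mmRead N G) (diagK (f κ u κ' u')))
      (|a| * C₀ + CB + 2 * (Fintype.card (Fib d) : ℝ) * CG * Cf * Zl (d + 1) (m / 2)) (m / 2) := by
  have hC₀ : 0 ≤ C₀ := h₀.nonneg
  have hCB : 0 ≤ CB := hB.nonneg
  have hCG : 0 ≤ CG := hGd.nonneg (Sum.inl 0)
  have hCf : 0 ≤ Cf := hf.nonneg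
  have hZ : 0 ≤ Zl (d + 1) (m / 2) := Zl_nonneg (half_pos hm)
  have hconj := locStencil₂_conjV_diagK (decays_mmRead hN hGd hm.le) hm hf
  intro κ u κ' u'
  have hexp : Real.exp (-m * l1 (u' - u)) ≤ Real.exp (-(m / 2) * l1 (u' - u)) :=
    Real.exp_le_exp.2 (by nlinarith [l1_nonneg (u' - u)])
  have hle : m / 2 ≤ m := (half_lt_self hm).le
  have e₀ : BiLoc (mmRead N (R₀ κ u κ' u')) u u (C₀ * Real.exp (-(m / 2) * l1 (u' - u))) (m / 2) :=
    biLoc_le_mono (h₀ κ u κ' u') (by positivity) (mul_le_mul_of_nonneg_left hexp hC₀) hle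
  have eB : BiLoc (RB κ u κ' u') u u (CB * Real.exp (-(m / 2) * l1 (u' - u))) (m / 2) :=
    biLoc_le_mono (hB κ u κ' u') (by positivity) (mul_le_mul_of_nonneg_left hexp hCB) hle
  have e₁ : BiLoc (-(a • mmRead N (R₀ κ u κ' u'))) u u (|a| * (C₀ * Real.exp (-(m / 2) * l1 (u' - u)))) (m / 2) :=
    biLoc_neg (biLoc_smul a e₀)
  have hsum := biLoc_add (biLoc_add e₁ eB) (hconj κ u κ' u')
  refine biLoc_le_mono hsum (by positivity) (le_of_eq ?_) le_rfl
  ring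

/-- [folklore] **THE SAME IN THE LITERAL DISPLAY** of `quarticStep_bref_of_laws` (symbol `a·ĥ − w·hB`, from the decay classes of `ĥ` and `hB`). -/
theorem locStencil₂_stepRemainder (hN : 1 ≤ N) {CG C₀ CB Ch Cb m : ℝ} (hm : 0 < m) (hGd : Decays G CG m)
    (h₀ : LocStencil₂ (fun κ u κ' u' => mmRead N (R₀ κ u κ' u')) C₀ m) (hB : LocStencil₂ RB CB m) (a w : ℝ)
    {hh hB' : Fin (d + 1) → (Fin (d + 1) → ℤ) → Fin (d + 1) → (Fin (d + 1) → ℤ) → (Fin (d + 1) → ℤ) → Fib d → ℝ}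
    (hhl : LocStencil₂ (fun κ u κ' u' => diagK (hh κ u κ' u')) Ch m) (hbl : LocStencil₂ (fun κ u κ' u' => diagK (hB' κ u κ' u')) Cb m) :
    LocStencil₂ (fun κ u κ' u' => -(a • mmRead N (R₀ κ u κ' u')) + RB κ u κ' u' +
        conjV (mmRead N G) (diagK fun p c => a * hh κ u κ' u' p c - w * hB' κ u κ' u' p c))
      (|a| * C₀ + CB + 2 * (Fintype.card (Fib d) : ℝ) * CG * (|a| * Ch + |w| * Cb) * Zl (d + 1) (m / 2)) (m / 2) := by
  have hCh : 0 ≤ Ch := hhl.nonneg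
  have hCb : 0 ≤ Cb := hbl.nonneg
  have hf : LocStencil₂ (fun κ u κ' u' => diagK fun p c => a * hh κ u κ' u' p c - w * hB' κ u κ' u' p c) (|a| * Ch + |w| * Cb) m := by
    intro κ u κ' u'
    have e : (diagK fun p c => a * hh κ u κ' u' p c - w * hB' κ u κ' u' p c) = a • diagK (hh κ u κ' u') - w • diagK (hB' κ u κ' u') := by
      classical
      funext x z e₁ e₂
      simp only [BorderedHessian.diagK_apply, Pi.sub_apply, Pi.smul_apply, smul_eq_mul]
      split_ifs <;> ring
    show BiLoc (diagK fun p c => a * hh κ u κ' u' p c - w * hB' κ u κ' u' p c) u u ((|a| * Ch + |w| * Cb) * Real.exp (-m * l1 (u' - u))) m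
    rw [e]
    have h1 := biLoc_smul a (hhl κ u κ' u')
    have h2 := biLoc_smul w (hbl κ u κ' u')
    have h3 := KernelWard.biLoc_sub h1 h2
    refine biLoc_le_mono h3 (by positivity) (le_of_eq ?_) le_rfl
    ring
  exact locStencil₂_stepRemainder_symbol hN hm hGd h₀ hB a hf

end Localisation

/-! ## §4 Zero tadpole against a spread sgn-symmetric propagator -/

section Tadpole

variable {N : ℕ} {G G' : MKer (d + 1) (Fib d)}
  {R₀ RB : Fin (d + 1) → (Fin (d + 1) → ℤ) → Fin (d + 1) → (Fin (d + 1) → ℤ) → MKer (d + 1) (Fib d)}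

/-- [folklore] **EVERY MEMBER OF THE DISPLAYED REMAINDER HAS ZERO TADPOLE** against any spread sgn-symmetric `G′` (§2 parity + §3 localisation
+ an1's `tadpole_eq_zero_of_parity`) — the END's `hRm0` ∕ (hΔ0) socket for the hereditary remainder, any local second symbol. -/
theorem tadpole_stepRemainder_symbol_eq_zero (hG's : Spr G') (hG't : trK G' = sgnK G') (hN : 1 ≤ N) {CG C₀ CB Cf m : ℝ} (hm : 0 < m)
    (hGd : Decays G CG m) (hGt : trK G = sgnK G)
    (h₀l : LocStencil₂ (fun κ u κ' u' => mmRead N (R₀ κ u κ' u')) C₀ m) (h₀ : ∀ κ u κ' u', trK (R₀ κ u κ' u') = -sgnK (R₀ κ u κ' u'))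
    (hBl : LocStencil₂ RB CB m) (hB : ∀ κ u κ' u', trK (RB κ u κ' u') = -sgnK (RB κ u κ' u')) (a : ℝ)
    {f : Fin (d + 1) → (Fin (d + 1) → ℤ) → Fin (d + 1) → (Fin (d + 1) → ℤ) → (Fin (d + 1) → ℤ) → Fib d → ℝ}
    (hf : LocStencil₂ (fun κ u κ' u' => diagK (f κ u κ' u')) Cf m)
    (κ : Fin (d + 1)) (u : Fin (d + 1) → ℤ) (κ' : Fin (d + 1)) (u' : Fin (d + 1) → ℤ) :
    tadpole G' (-(a • mmRead N (R₀ κ u κ' u')) + RB κ u κ' u' + conjV (mmRead N G) (diagK (f κ u κ' u'))) = 0 :=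
  tadpole_eq_zero_of_parity hG's hG't
    (loc_of_locStencil₂ (locStencil₂_stepRemainder_symbol hN hm hGd h₀l hBl a hf) (half_pos hm) κ u κ' u')
    (parityOdd_stepRemainder_symbol hGt h₀ hB a f κ u κ' u')

/-- [folklore] **THE SAME IN THE LITERAL DISPLAY** of `quarticStep_bref_of_laws`. -/
theorem tadpole_stepRemainder_eq_zero (hG's : Spr G') (hG't : trK G' = sgnK G') (hN : 1 ≤ N) {CG C₀ CB Ch Cb m : ℝ} (hm : 0 < m)
    (hGd : Decays G CG m) (hGt : trK G = sgnK G)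
    (h₀l : LocStencil₂ (fun κ u κ' u' => mmRead N (R₀ κ u κ' u')) C₀ m) (h₀ : ∀ κ u κ' u', trK (R₀ κ u κ' u') = -sgnK (R₀ κ u κ' u'))
    (hBl : LocStencil₂ RB CB m) (hB : ∀ κ u κ' u', trK (RB κ u κ' u') = -sgnK (RB κ u κ' u')) (a w : ℝ)
    {hh hB' : Fin (d + 1) → (Fin (d + 1) → ℤ) → Fin (d + 1) → (Fin (d + 1) → ℤ) → (Fin (d + 1) → ℤ) → Fib d → ℝ}
    (hhl : LocStencil₂ (fun κ u κ' u' => diagK (hh κ u κ' u')) Ch m) (hbl : LocStencil₂ (fun κ u κ' u' => diagK (hB' κ u κ' u')) Cb m)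
    (κ : Fin (d + 1)) (u : Fin (d + 1) → ℤ) (κ' : Fin (d + 1)) (u' : Fin (d + 1) → ℤ) :
    tadpole G' (-(a • mmRead N (R₀ κ u κ' u')) + RB κ u κ' u' +
      conjV (mmRead N G) (diagK fun p c => a * hh κ u κ' u' p c - w * hB' κ u κ' u' p c)) = 0 :=
  tadpole_eq_zero_of_parity hG's hG't
    (loc_of_locStencil₂ (locStencil₂_stepRemainder hN hm hGd h₀l hBl a w hhl hbl) (half_pos hm) κ u κ' u')
    (parityOdd_stepRemainder hGt h₀ hB a w hh hB' κ u κ' u')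

end Tadpole


end Summit.QuantumFields.BalabanUV.Beta.SecondOrderStepRemainder

end
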